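import Literature.Topology.FourManifolds.StandardTrisectionSlotSymmetry
import Literature.Topology.FourManifolds.SurfaceGroupAbelianisationKernels
import Literature.Algebra.Lie.SurfaceLieAlgebra
import Summits.SmoothPoincare4.SmoothPoincare4.Theorems.CongruenceShadowsNilpotentShadowsStandardJohnsonRealisers
import Summits.SmoothPoincare4.SmoothPoincare4.Theorems.CongruenceShadowsNilpotentShadowsStandardGlueNilpotentBasis
import Literature.Topology.FourManifolds.SymplecticElementaryMoves
import HarnessLib

/-!
# Helper II for stub `stub_layerStepZero` (line `nilpotent-genus-class`, crux
`CongruenceShadows.ShadowApproximation`, item stmt-SmoothPoincare4-14595): a Goeritz–Johnson realiser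

Genus `3`, `S = S₃`, `Nᵢ = s4Kernels i`, `γₖ₊₁ = (⊤).lowerCentralSeries k`.  Granted the realisation
hypothesis (REAL) of the stub (every `±`-isometry of `H₁(S₃)` stabilising the coordinate Lagrangians
`Λ₀, Λ₁` is induced by some `x ∈ Stab N₀ ∩ Stab N₁`), we exhibit ONE element
`y₁ ∈ Stab N₀ ∩ Stab N₁` which is IA (`y₁ s · s⁻¹ ∈ γ₂`) and whose first Johnson value at the cut
letter `b₀` of `N₂` is NOT killed by `N₂`: `y₁(b₀) b₀⁻¹ ≡ ([b₁,b₀][b₁,b₂])⁻¹ (mod γ₃)`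
(`exists_goeritzJohnson`).  Construction: `y₁ = g ∘ β ∘ g⁻¹` with
* `β` Johnson's genus-1 bounding-pair map on handles `0, 1` (the landed `exists_bpAut`:
  `x₀ ↦ c₀b₁⁻¹x₀b₁c₀⁻¹`, `a₁ ↦ c₀b₁⁻¹c₀⁻¹b₁a₁c₀⁻¹`, `b₁ ↦ c₀b₁c₀⁻¹`, `c₀ = [a₀,b₀]`), which stabilises
  `N₀`, `N₁` (and `N₂`) on the nose, is IA, and has `β(b₀)b₀⁻¹ ≡ [b₁,b₀]⁻¹`, `β(b₂) = b₂`;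
* `g ∈ Stab N₀ ∩ Stab N₁` a realiser (REAL) of the slide `F₀ = moveZ 0 2 (-1)` of `H₁`
  (`b₀ ↦ b₀ + b₂`, `a₂ ↦ a₂ - a₀`, an isometry fixing `Λ₀ = ⟨a₀,a₁,b₂⟩` and `Λ₁ = ⟨a₀,b₁,a₂⟩`),
so that `τ(y₁) = g_* τ(β) = a₀ ∧ (b₀ + b₂) ∧ b₁` acquires the coefficient `-1` at `a₀ ∧ b₁ ∧ b₂`
(the generator of `Der₁ / 𝔠₁`); the class-2 computation is done in `S ⧸ γ₃` with the landed
IA-calculus (`…JohnsonClassTwo`).  No definitions.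
-/

set_option linter.dupNamespace false

noncomputable section

open Literature.Topology.FourManifolds Literature.Algebra.Lie Multiplicative Subgroup
open Summit.SmoothPoincare4.SmoothPoincare4.Theorems.NilpotentShadowsStandard.SaturatedTorsorDescent
open Literature.Topology.FourManifolds.RelatorAut (s4Kernels_zero s4Kernels_one map_normalClosure_eq_of)
open scoped commutatorElement

namespace Summit.SmoothPoincare4.SmoothPoincare4.Theorems.ShadowApproximation.NilpotentGenusClass


/-! ## The slide `F₀ = moveZ 0 2 (-1)` of `H₁`: `b₀ ↦ b₀ + b₂`, `a₂ ↦ a₂ - a₀` -/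


/-- `F₀` fixes `δ_x` for every letter `x ∉ {b₀, a₂}`. [folklore] -/
theorem F0_single_of_ne (x : surfaceGen 3) (h1 : x ≠ (2, false)) (h2 : x ≠ (0, true)) :
    (moveZ (0 : Fin 3) 2 (by decide) (-1)) (Pi.single x (1 : ℤ) : surfaceGen 3 → ℤ) = (Pi.single x (1 : ℤ) : surfaceGen 3 → ℤ) := by
  rw [moveZ_apply, Pi.single_eq_of_ne h1.symm, Pi.single_eq_of_ne h2.symm]
  simp

/-- `F₀ δ_{b₀} = δ_{b₀} + δ_{b₂}`. [folklore] -/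
theorem F0_single_b0 : (moveZ (0 : Fin 3) 2 (by decide) (-1)) (Pi.single ((0 : Fin 3), true) (1 : ℤ) : surfaceGen 3 → ℤ) = (Pi.single ((0 : Fin 3), true) (1 : ℤ) : surfaceGen 3 → ℤ) + (Pi.single ((2 : Fin 3), true) (1 : ℤ) : surfaceGen 3 → ℤ) := by
  rw [moveZ_apply, Pi.single_eq_of_ne (by decide), Pi.single_eq_same]
  simp

/-- `F₀ δ_{a₂} = δ_{a₂} - δ_{a₀}`. [folklore] -/
theorem F0_single_a2 : (moveZ (0 : Fin 3) 2 (by decide) (-1)) (Pi.single ((2 : Fin 3), false) (1 : ℤ) : surfaceGen 3 → ℤ) = (Pi.single ((2 : Fin 3), false) (1 : ℤ) : surfaceGen 3 → ℤ) - (Pi.single ((0 : Fin 3), false) (1 : ℤ) : surfaceGen 3 → ℤ) := by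
  rw [moveZ_apply, Pi.single_eq_same, Pi.single_eq_of_ne (by decide)]
  simp [sub_eq_add_neg]

/-- `F₀` is an isometry of the intersection form. [folklore] -/
theorem F0_iso (u v : (surfaceGen 3 → ℤ)) : symplForm ((moveZ (0 : Fin 3) 2 (by decide) (-1)) u) ((moveZ (0 : Fin 3) 2 (by decide) (-1)) v) = 1 * symplForm u v := by
  rw [one_mul]; exact symplForm_moveZ _ _ u v

/-- `Λ₀ = span {δ_{a₀}, δ_{a₁}, δ_{b₂}}`. [folklore] -/
theorem Λ0_eq : (Submodule.span ℤ ((fun y => (Pi.single y (1 : ℤ) : surfaceGen 3 → ℤ)) '' s4CutSystem 0 0)) = Submodule.span ℤ {(Pi.single ((0 : Fin 3), false) (1 : ℤ) : surfaceGen 3 → ℤ), (Pi.single ((1 : Fin 3), false) (1 : ℤ) : surfaceGen 3 → ℤ), (Pi.single ((2 : Fin 3), true) (1 : ℤ) : surfaceGen 3 → ℤ)} := by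
  rw [s4CutSystem_zero]
  simp [s4Gens, Set.image_insert_eq, Set.image_singleton]

/-- `Λ₁ = span {δ_{a₀}, δ_{b₁}, δ_{a₂}}`. [folklore] -/
theorem Λ1_eq : (Submodule.span ℤ ((fun y => (Pi.single y (1 : ℤ) : surfaceGen 3 → ℤ)) '' s4CutSystem 0 1)) = Submodule.span ℤ {(Pi.single ((0 : Fin 3), false) (1 : ℤ) : surfaceGen 3 → ℤ), (Pi.single ((1 : Fin 3), true) (1 : ℤ) : surfaceGen 3 → ℤ), (Pi.single ((2 : Fin 3), false) (1 : ℤ) : surfaceGen 3 → ℤ)} := by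
  rw [s4CutSystem_zero]
  simp [s4Gens, Set.image_insert_eq, Set.image_singleton]

/-- `F₀` fixes `Λ₀` (pointwise on its basis). [folklore] -/
theorem F0_Λ0 : (Submodule.span ℤ ((fun y => (Pi.single y (1 : ℤ) : surfaceGen 3 → ℤ)) '' s4CutSystem 0 0)).map ((moveZ (0 : Fin 3) 2 (by decide) (-1))).toLinearMap = (Submodule.span ℤ ((fun y => (Pi.single y (1 : ℤ) : surfaceGen 3 → ℤ)) '' s4CutSystem 0 0)) := by
  rw [Λ0_eq, Submodule.map_span, Set.image_insert_eq, Set.image_insert_eq, Set.image_singleton,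
    LinearEquiv.coe_coe, F0_single_of_ne _ (by decide) (by decide),
    F0_single_of_ne _ (by decide) (by decide), F0_single_of_ne _ (by decide) (by decide)]

/-- `F₀` stabilises `Λ₁` (`δ_{a₂} ↦ δ_{a₂} - δ_{a₀}`). [folklore] -/
theorem F0_Λ1 : (Submodule.span ℤ ((fun y => (Pi.single y (1 : ℤ) : surfaceGen 3 → ℤ)) '' s4CutSystem 0 1)).map ((moveZ (0 : Fin 3) 2 (by decide) (-1))).toLinearMap = (Submodule.span ℤ ((fun y => (Pi.single y (1 : ℤ) : surfaceGen 3 → ℤ)) '' s4CutSystem 0 1)) := by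
  rw [Λ1_eq, Submodule.map_span, Set.image_insert_eq, Set.image_insert_eq, Set.image_singleton,
    LinearEquiv.coe_coe, F0_single_of_ne _ (by decide) (by decide),
    F0_single_of_ne _ (by decide) (by decide), F0_single_a2]
  apply le_antisymm
  · rw [Submodule.span_le]
    rintro v (rfl | rfl | rfl)
    · exact Submodule.subset_span (by simp)
    · exact Submodule.subset_span (by simp)
    · exact Submodule.sub_mem _ (Submodule.subset_span (by simp)) (Submodule.subset_span (by simp))
  · rw [Submodule.span_le]
    rintro v (rfl | rfl | rfl)
    · exact Submodule.subset_span (by simp)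
    · exact Submodule.subset_span (by simp)
    · have e : (Pi.single ((2 : Fin 3), false) (1 : ℤ) : surfaceGen 3 → ℤ) =
          ((Pi.single ((2 : Fin 3), false) (1 : ℤ) : surfaceGen 3 → ℤ) - (Pi.single ((0 : Fin 3), false) (1 : ℤ) : surfaceGen 3 → ℤ)) + (Pi.single ((0 : Fin 3), false) (1 : ℤ) : surfaceGen 3 → ℤ) := by abel
      rw [SetLike.mem_coe, e]
      exact Submodule.add_mem _ (Submodule.subset_span (by simp)) (Submodule.subset_span (by simp))

/-! ## The bounding-pair map `β` on handles `0, 1` -/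

/-- **The bounding-pair map of `S₃`** (the landed `exists_bpAut` at `n = 0`) with its values and
inverse values on the six letters (`c₀ = [a₀, b₀]`). [cite: Johnson1980AbelianQuotient, §4] -/
theorem exists_bp : ∃ β : (SurfaceGroup 3) ≃* (SurfaceGroup 3),
    (β ((SurfaceGroup.a 0 : SurfaceGroup 3)) = ⁅(SurfaceGroup.a 0 : SurfaceGroup 3), (SurfaceGroup.b 0 : SurfaceGroup 3)⁆ * ((SurfaceGroup.b 1 : SurfaceGroup 3))⁻¹ * ((SurfaceGroup.a 0 : SurfaceGroup 3)) * ((SurfaceGroup.b 1 : SurfaceGroup 3)) * ⁅(SurfaceGroup.a 0 : SurfaceGroup 3), (SurfaceGroup.b 0 : SurfaceGroup 3)⁆⁻¹ ∧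
     β ((SurfaceGroup.b 0 : SurfaceGroup 3)) = ⁅(SurfaceGroup.a 0 : SurfaceGroup 3), (SurfaceGroup.b 0 : SurfaceGroup 3)⁆ * ((SurfaceGroup.b 1 : SurfaceGroup 3))⁻¹ * ((SurfaceGroup.b 0 : SurfaceGroup 3)) * ((SurfaceGroup.b 1 : SurfaceGroup 3)) * ⁅(SurfaceGroup.a 0 : SurfaceGroup 3), (SurfaceGroup.b 0 : SurfaceGroup 3)⁆⁻¹ ∧
     β ((SurfaceGroup.a 1 : SurfaceGroup 3)) = ⁅(SurfaceGroup.a 0 : SurfaceGroup 3), (SurfaceGroup.b 0 : SurfaceGroup 3)⁆ * ((SurfaceGroup.b 1 : SurfaceGroup 3))⁻¹ * ⁅(SurfaceGroup.a 0 : SurfaceGroup 3), (SurfaceGroup.b 0 : SurfaceGroup 3)⁆⁻¹ * ((SurfaceGroup.b 1 : SurfaceGroup 3)) * ((SurfaceGroup.a 1 : SurfaceGroup 3)) * ⁅(SurfaceGroup.a 0 : SurfaceGroup 3), (SurfaceGroup.b 0 : SurfaceGroup 3)⁆⁻¹ ∧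
     β ((SurfaceGroup.b 1 : SurfaceGroup 3)) = ⁅(SurfaceGroup.a 0 : SurfaceGroup 3), (SurfaceGroup.b 0 : SurfaceGroup 3)⁆ * ((SurfaceGroup.b 1 : SurfaceGroup 3)) * ⁅(SurfaceGroup.a 0 : SurfaceGroup 3), (SurfaceGroup.b 0 : SurfaceGroup 3)⁆⁻¹ ∧
     β ((SurfaceGroup.a 2 : SurfaceGroup 3)) = (SurfaceGroup.a 2 : SurfaceGroup 3) ∧ β ((SurfaceGroup.b 2 : SurfaceGroup 3)) = (SurfaceGroup.b 2 : SurfaceGroup 3)) ∧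
    (β.symm ((SurfaceGroup.a 0 : SurfaceGroup 3)) = ((SurfaceGroup.b 1 : SurfaceGroup 3)) * ⁅(SurfaceGroup.a 0 : SurfaceGroup 3), (SurfaceGroup.b 0 : SurfaceGroup 3)⁆⁻¹ * ((SurfaceGroup.a 0 : SurfaceGroup 3)) * ⁅(SurfaceGroup.a 0 : SurfaceGroup 3), (SurfaceGroup.b 0 : SurfaceGroup 3)⁆ * ((SurfaceGroup.b 1 : SurfaceGroup 3))⁻¹ ∧
     β.symm ((SurfaceGroup.b 0 : SurfaceGroup 3)) = ((SurfaceGroup.b 1 : SurfaceGroup 3)) * ⁅(SurfaceGroup.a 0 : SurfaceGroup 3), (SurfaceGroup.b 0 : SurfaceGroup 3)⁆⁻¹ * ((SurfaceGroup.b 0 : SurfaceGroup 3)) * ⁅(SurfaceGroup.a 0 : SurfaceGroup 3), (SurfaceGroup.b 0 : SurfaceGroup 3)⁆ * ((SurfaceGroup.b 1 : SurfaceGroup 3))⁻¹ ∧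
     β.symm ((SurfaceGroup.a 1 : SurfaceGroup 3)) = ((SurfaceGroup.b 1 : SurfaceGroup 3)) * ⁅(SurfaceGroup.a 0 : SurfaceGroup 3), (SurfaceGroup.b 0 : SurfaceGroup 3)⁆⁻¹ * ((SurfaceGroup.b 1 : SurfaceGroup 3))⁻¹ * ⁅(SurfaceGroup.a 0 : SurfaceGroup 3), (SurfaceGroup.b 0 : SurfaceGroup 3)⁆ * ((SurfaceGroup.a 1 : SurfaceGroup 3)) * ((SurfaceGroup.b 1 : SurfaceGroup 3)) * ⁅(SurfaceGroup.a 0 : SurfaceGroup 3), (SurfaceGroup.b 0 : SurfaceGroup 3)⁆ * ((SurfaceGroup.b 1 : SurfaceGroup 3))⁻¹ ∧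
     β.symm ((SurfaceGroup.b 1 : SurfaceGroup 3)) = ((SurfaceGroup.b 1 : SurfaceGroup 3)) * ⁅(SurfaceGroup.a 0 : SurfaceGroup 3), (SurfaceGroup.b 0 : SurfaceGroup 3)⁆⁻¹ * ((SurfaceGroup.b 1 : SurfaceGroup 3)) * ⁅(SurfaceGroup.a 0 : SurfaceGroup 3), (SurfaceGroup.b 0 : SurfaceGroup 3)⁆ * ((SurfaceGroup.b 1 : SurfaceGroup 3))⁻¹ ∧
     β.symm ((SurfaceGroup.a 2 : SurfaceGroup 3)) = (SurfaceGroup.a 2 : SurfaceGroup 3) ∧ β.symm ((SurfaceGroup.b 2 : SurfaceGroup 3)) = (SurfaceGroup.b 2 : SurfaceGroup 3)) := by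
  obtain ⟨β, hβ, hβ'⟩ := exists_bpAut 0
  have h10 := fin_one_ne_zero 0
  have h20 := fin_two_ne_zero 0
  have h21 := fin_two_ne_one 0
  refine ⟨β, ⟨?_, ?_, ?_, ?_, ?_, ?_⟩, ⟨?_, ?_, ?_, ?_, ?_, ?_⟩⟩ <;>
    simp only [SurfaceGroup.a, SurfaceGroup.b, PresentedGroup.of, hβ, hβ', FreeGroup.lift_apply_of,
      map_mul, map_inv, map_commutatorElement, genA, genB, if_true, if_false, h10, h20, h21,
      Prod.mk.injEq, and_true, and_false, Bool.false_eq_true, Bool.true_eq_false]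

/-! ## The realiser -/

section Realise

variable (hR : ∀ (F : (surfaceGen 3 → ℤ) ≃ₗ[ℤ] (surfaceGen 3 → ℤ)) (ε : ℤ), (ε = 1 ∨ ε = -1) →
    (∀ u v : surfaceGen 3 → ℤ, symplForm (F u) (F v) = ε * symplForm u v) →
    (Submodule.span ℤ ((fun y => (Pi.single y (1 : ℤ) : surfaceGen 3 → ℤ)) ''
        s4CutSystem 0 0)).map F.toLinearMap =
      Submodule.span ℤ ((fun y => (Pi.single y (1 : ℤ) : surfaceGen 3 → ℤ)) '' s4CutSystem 0 0) →
    (Submodule.span ℤ ((fun y => (Pi.single y (1 : ℤ) : surfaceGen 3 → ℤ)) ''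
        s4CutSystem 0 1)).map F.toLinearMap =
      Submodule.span ℤ ((fun y => (Pi.single y (1 : ℤ) : surfaceGen 3 → ℤ)) '' s4CutSystem 0 1) →
    ∃ x : SurfaceGroup 3 ≃* SurfaceGroup 3,
      (s4Kernels 0).map x.toMonoidHom = s4Kernels 0 ∧
      (s4Kernels 1).map x.toMonoidHom = s4Kernels 1 ∧
      ∀ s : SurfaceGroup 3,
        toAdd (SurfaceGroup.abelianize 3 (x s)) = F (toAdd (SurfaceGroup.abelianize 3 s)))

/-- A conjugate `e f e⁻¹` of a stabiliser `f` of `P` by a stabiliser `e` of `P` stabilises `P`.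
[folklore] -/
theorem map_conj_of_map_eq {G : Type*} [Group G] (e f : G ≃* G) {P : Subgroup G}
    (he : P.map e.toMonoidHom = P) (hf : P.map f.toMonoidHom = P) :
    P.map (e.symm.trans (f.trans e)).toMonoidHom = P := by
  have key : ∀ φ : G ≃* G, P.map φ.toMonoidHom = P → ∀ y, φ.symm y ∈ P ↔ y ∈ P :=
    fun φ hφ y => by rw [← Subgroup.mem_map_equiv, hφ]
  have key' : ∀ φ : G ≃* G, P.map φ.toMonoidHom = P → ∀ y, φ y ∈ P ↔ y ∈ P :=
    fun φ hφ y => by rw [← key φ hφ (φ y), MulEquiv.symm_apply_apply]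
  ext x
  rw [Subgroup.mem_map_equiv, MulEquiv.symm_trans_apply, MulEquiv.symm_trans_apply,
    MulEquiv.symm_symm, key' e he, key f hf, key e he]

/-- Membership in `ker ab = γ₂` from equal abelianisations. [folklore] -/
theorem mul_inv_mem_γ₂ {s t : (SurfaceGroup 3)} (h : toAdd (SurfaceGroup.abelianize 3 s) = toAdd (SurfaceGroup.abelianize 3 t)) : s * t⁻¹ ∈ ((⊤ : Subgroup (SurfaceGroup 3)).lowerCentralSeries 1) := by
  have hk : s * t⁻¹ ∈ (SurfaceGroup.abelianize 3).ker := by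
    rw [MonoidHom.mem_ker, map_mul, map_inv, toAdd.injective h, mul_inv_cancel]
  rwa [SurfaceGroup.ker_abelianize_eq_lowerCentralSeries] at hk

include hR in
/-- **A Goeritz–Johnson realiser.** Some `y₁ ∈ Stab N₀ ∩ Stab N₁` is IA with first Johnson value
`y₁(b₀) b₀⁻¹ ≡ ([b₁,b₀][b₁,b₂])⁻¹ (mod γ₃)` — not killed by `N₂ = ⟪b₀,a₁,a₂⟫` (its image
`[b̄₁,b̄₂]⁻¹` generates a direct summand of `γ₂/γ₃` of `S₃ ⧸ N₂ ≅ F⟨a₀,b₁,b₂⟩`). [folklore] -/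
theorem exists_goeritzJohnson : ∃ y₁ : (SurfaceGroup 3) ≃* (SurfaceGroup 3),
    (s4Kernels 0).map y₁.toMonoidHom = (s4Kernels 0) ∧ (s4Kernels 1).map y₁.toMonoidHom = (s4Kernels 1) ∧
    (∀ s, y₁ s * s⁻¹ ∈ ((⊤ : Subgroup (SurfaceGroup 3)).lowerCentralSeries 1)) ∧
    y₁ ((SurfaceGroup.b 0 : SurfaceGroup 3)) * ((SurfaceGroup.b 0 : SurfaceGroup 3))⁻¹ * (⁅(SurfaceGroup.b 1 : SurfaceGroup 3), (SurfaceGroup.b 0 : SurfaceGroup 3)⁆ * ⁅(SurfaceGroup.b 1 : SurfaceGroup 3), (SurfaceGroup.b 2 : SurfaceGroup 3)⁆) ∈ ((⊤ : Subgroup (SurfaceGroup 3)).lowerCentralSeries 2) := by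
  obtain ⟨β, ⟨ha0, hb0, ha1, hb1, ha2, hb2⟩, ⟨ha0', hb0', ha1', hb1', ha2', hb2'⟩⟩ := exists_bp
  obtain ⟨g, hg0, hg1, hg⟩ := hR _ 1 (Or.inl rfl) F0_iso F0_Λ0 F0_Λ1
  haveI hn0 : (s4Kernels 0).Normal := s4Kernels_isGroupTrisection_holds.normal 0
  haveI hn1 : (s4Kernels 1).Normal := s4Kernels_isGroupTrisection_holds.normal 1
  -- letters and `c₀ = [a₀, b₀] = a₀ · (b₀ a₀⁻¹ b₀⁻¹)` in `N₀`, `N₁`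
  have a0N0 : ((SurfaceGroup.a 0 : SurfaceGroup 3)) ∈ (s4Kernels 0) := subset_normalClosure (by simp)
  have a1N0 : ((SurfaceGroup.a 1 : SurfaceGroup 3)) ∈ (s4Kernels 0) := subset_normalClosure (by simp)
  have b2N0 : ((SurfaceGroup.b 2 : SurfaceGroup 3)) ∈ (s4Kernels 0) := subset_normalClosure (by simp)
  have a0N1 : ((SurfaceGroup.a 0 : SurfaceGroup 3)) ∈ (s4Kernels 1) := subset_normalClosure (by simp)
  have b1N1 : ((SurfaceGroup.b 1 : SurfaceGroup 3)) ∈ (s4Kernels 1) := subset_normalClosure (by simp)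
  have a2N1 : ((SurfaceGroup.a 2 : SurfaceGroup 3)) ∈ (s4Kernels 1) := subset_normalClosure (by simp)
  have hC0 : ⁅(SurfaceGroup.a 0 : SurfaceGroup 3), (SurfaceGroup.b 0 : SurfaceGroup 3)⁆ ∈ (s4Kernels 0) := by
    rw [commutatorElement_def, mul_assoc, mul_assoc]
    exact mul_mem a0N0 (by simpa [mul_assoc] using hn0.conj_mem _ (inv_mem a0N0) ((SurfaceGroup.b 0 : SurfaceGroup 3)))
  have hC1 : ⁅(SurfaceGroup.a 0 : SurfaceGroup 3), (SurfaceGroup.b 0 : SurfaceGroup 3)⁆ ∈ (s4Kernels 1) := by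
    rw [commutatorElement_def, mul_assoc, mul_assoc]
    exact mul_mem a0N1 (by simpa [mul_assoc] using hn1.conj_mem _ (inv_mem a0N1) ((SurfaceGroup.b 0 : SurfaceGroup 3)))
  have cj0 : ∀ (h x : (SurfaceGroup 3)), x ∈ (s4Kernels 0) → h * x * h⁻¹ ∈ (s4Kernels 0) := fun h x hx =>
    (inferInstance : (s4Kernels 0).Normal).conj_mem x hx h
  have cj0' : ∀ (h x : (SurfaceGroup 3)), x ∈ (s4Kernels 0) → h⁻¹ * x * h ∈ (s4Kernels 0) := fun h x hx => by
    simpa using (inferInstance : (s4Kernels 0).Normal).conj_mem x hx h⁻¹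
  -- `β` stabilises `N₀` and `N₁`
  have hβ0 : (s4Kernels 0).map β.toMonoidHom = (s4Kernels 0) := by
    rw [s4Kernels_zero]
    refine map_normalClosure_eq_of _ _ _ ?_ ?_
    · rintro x (rfl | rfl | rfl)
      · rw [ha0, ← s4Kernels_zero]
        have e : ⁅(SurfaceGroup.a 0 : SurfaceGroup 3), (SurfaceGroup.b 0 : SurfaceGroup 3)⁆ * ((SurfaceGroup.b 1 : SurfaceGroup 3))⁻¹ * ((SurfaceGroup.a 0 : SurfaceGroup 3)) * ((SurfaceGroup.b 1 : SurfaceGroup 3)) * ⁅(SurfaceGroup.a 0 : SurfaceGroup 3), (SurfaceGroup.b 0 : SurfaceGroup 3)⁆⁻¹ =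
            ⁅(SurfaceGroup.a 0 : SurfaceGroup 3), (SurfaceGroup.b 0 : SurfaceGroup 3)⁆ * (((SurfaceGroup.b 1 : SurfaceGroup 3))⁻¹ * ((SurfaceGroup.a 0 : SurfaceGroup 3)) * ((SurfaceGroup.b 1 : SurfaceGroup 3))) * ⁅(SurfaceGroup.a 0 : SurfaceGroup 3), (SurfaceGroup.b 0 : SurfaceGroup 3)⁆⁻¹ := by group
        rw [e]; exact cj0 _ _ (cj0' _ _ a0N0)
      · rw [ha1, ← s4Kernels_zero]
        have e : ⁅(SurfaceGroup.a 0 : SurfaceGroup 3), (SurfaceGroup.b 0 : SurfaceGroup 3)⁆ * ((SurfaceGroup.b 1 : SurfaceGroup 3))⁻¹ * ⁅(SurfaceGroup.a 0 : SurfaceGroup 3), (SurfaceGroup.b 0 : SurfaceGroup 3)⁆⁻¹ * ((SurfaceGroup.b 1 : SurfaceGroup 3)) * ((SurfaceGroup.a 1 : SurfaceGroup 3)) * ⁅(SurfaceGroup.a 0 : SurfaceGroup 3), (SurfaceGroup.b 0 : SurfaceGroup 3)⁆⁻¹ =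
            ⁅(SurfaceGroup.a 0 : SurfaceGroup 3), (SurfaceGroup.b 0 : SurfaceGroup 3)⁆ * ((((SurfaceGroup.b 1 : SurfaceGroup 3))⁻¹ * ⁅(SurfaceGroup.a 0 : SurfaceGroup 3), (SurfaceGroup.b 0 : SurfaceGroup 3)⁆⁻¹ * ((SurfaceGroup.b 1 : SurfaceGroup 3))) * ((SurfaceGroup.a 1 : SurfaceGroup 3))) * ⁅(SurfaceGroup.a 0 : SurfaceGroup 3), (SurfaceGroup.b 0 : SurfaceGroup 3)⁆⁻¹ := by group
        rw [e]; exact cj0 _ _ (mul_mem (cj0' _ _ (inv_mem hC0)) a1N0)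
      · rw [hb2, ← s4Kernels_zero]; exact b2N0
    · rintro x (rfl | rfl | rfl)
      · rw [ha0', ← s4Kernels_zero]
        have e : ((SurfaceGroup.b 1 : SurfaceGroup 3)) * ⁅(SurfaceGroup.a 0 : SurfaceGroup 3), (SurfaceGroup.b 0 : SurfaceGroup 3)⁆⁻¹ * ((SurfaceGroup.a 0 : SurfaceGroup 3)) * ⁅(SurfaceGroup.a 0 : SurfaceGroup 3), (SurfaceGroup.b 0 : SurfaceGroup 3)⁆ * ((SurfaceGroup.b 1 : SurfaceGroup 3))⁻¹ =
            ((SurfaceGroup.b 1 : SurfaceGroup 3)) * (⁅(SurfaceGroup.a 0 : SurfaceGroup 3), (SurfaceGroup.b 0 : SurfaceGroup 3)⁆⁻¹ * ((SurfaceGroup.a 0 : SurfaceGroup 3)) * ⁅(SurfaceGroup.a 0 : SurfaceGroup 3), (SurfaceGroup.b 0 : SurfaceGroup 3)⁆) * ((SurfaceGroup.b 1 : SurfaceGroup 3))⁻¹ := by group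
        rw [e]; exact cj0 _ _ (cj0' _ _ a0N0)
      · rw [ha1', ← s4Kernels_zero]
        have e : ((SurfaceGroup.b 1 : SurfaceGroup 3)) * ⁅(SurfaceGroup.a 0 : SurfaceGroup 3), (SurfaceGroup.b 0 : SurfaceGroup 3)⁆⁻¹ * ((SurfaceGroup.b 1 : SurfaceGroup 3))⁻¹ * ⁅(SurfaceGroup.a 0 : SurfaceGroup 3), (SurfaceGroup.b 0 : SurfaceGroup 3)⁆ * ((SurfaceGroup.a 1 : SurfaceGroup 3)) * ((SurfaceGroup.b 1 : SurfaceGroup 3)) * ⁅(SurfaceGroup.a 0 : SurfaceGroup 3), (SurfaceGroup.b 0 : SurfaceGroup 3)⁆ * ((SurfaceGroup.b 1 : SurfaceGroup 3))⁻¹ =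
            (((SurfaceGroup.b 1 : SurfaceGroup 3)) * ⁅(SurfaceGroup.a 0 : SurfaceGroup 3), (SurfaceGroup.b 0 : SurfaceGroup 3)⁆⁻¹ * ((SurfaceGroup.b 1 : SurfaceGroup 3))⁻¹) * ⁅(SurfaceGroup.a 0 : SurfaceGroup 3), (SurfaceGroup.b 0 : SurfaceGroup 3)⁆ * ((SurfaceGroup.a 1 : SurfaceGroup 3)) * (((SurfaceGroup.b 1 : SurfaceGroup 3)) * ⁅(SurfaceGroup.a 0 : SurfaceGroup 3), (SurfaceGroup.b 0 : SurfaceGroup 3)⁆ * ((SurfaceGroup.b 1 : SurfaceGroup 3))⁻¹) := by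
          group
        rw [e]
        exact mul_mem (mul_mem (mul_mem (cj0 _ _ (inv_mem hC0)) hC0) a1N0) (cj0 _ _ hC0)
      · rw [hb2', ← s4Kernels_zero]; exact b2N0
  have hβ1 : (s4Kernels 1).map β.toMonoidHom = (s4Kernels 1) := by
    rw [s4Kernels_one]
    refine map_normalClosure_eq_of _ _ _ ?_ ?_
    · rintro x (rfl | rfl | rfl)
      · rw [ha0, ← s4Kernels_one]
        exact mul_mem (mul_mem (mul_mem (mul_mem hC1 (inv_mem b1N1)) a0N1) b1N1) (inv_mem hC1)
      · rw [hb1, ← s4Kernels_one]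
        exact mul_mem (mul_mem hC1 b1N1) (inv_mem hC1)
      · rw [ha2, ← s4Kernels_one]; exact a2N1
    · rintro x (rfl | rfl | rfl)
      · rw [ha0', ← s4Kernels_one]
        exact mul_mem (mul_mem (mul_mem (mul_mem b1N1 (inv_mem hC1)) a0N1) hC1) (inv_mem b1N1)
      · rw [hb1', ← s4Kernels_one]
        exact mul_mem (mul_mem (mul_mem (mul_mem b1N1 (inv_mem hC1)) b1N1) hC1) (inv_mem b1N1)
      · rw [ha2', ← s4Kernels_one]; exact a2N1
  -- `β` is IA
  have hβIA : ∀ s, β s * s⁻¹ ∈ ((⊤ : Subgroup (SurfaceGroup 3)).lowerCentralSeries 1) := by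
    have hhom : (SurfaceGroup.abelianize 3).comp β.toMonoidHom = SurfaceGroup.abelianize 3 := by
      refine PresentedGroup.ext fun x => ?_
      rw [MonoidHom.comp_apply, MulEquiv.coe_toMonoidHom]
      apply toAdd.injective
      obtain ⟨j, c⟩ := x
      fin_cases j <;> cases c
      · change toAdd (SurfaceGroup.abelianize 3 (β ((SurfaceGroup.a 0 : SurfaceGroup 3)))) = toAdd (SurfaceGroup.abelianize 3 ((SurfaceGroup.a 0 : SurfaceGroup 3)))
        rw [ha0]; simp only [map_mul, map_inv, toAdd_mul, toAdd_inv,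
          commutatorElement_def]; abel
      · change toAdd (SurfaceGroup.abelianize 3 (β ((SurfaceGroup.b 0 : SurfaceGroup 3)))) = toAdd (SurfaceGroup.abelianize 3 ((SurfaceGroup.b 0 : SurfaceGroup 3)))
        rw [hb0]; simp only [map_mul, map_inv, toAdd_mul, toAdd_inv,
          commutatorElement_def]; abel
      · change toAdd (SurfaceGroup.abelianize 3 (β ((SurfaceGroup.a 1 : SurfaceGroup 3)))) = toAdd (SurfaceGroup.abelianize 3 ((SurfaceGroup.a 1 : SurfaceGroup 3)))
        rw [ha1]; simp only [map_mul, map_inv, toAdd_mul, toAdd_inv,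
          commutatorElement_def]; abel
      · change toAdd (SurfaceGroup.abelianize 3 (β ((SurfaceGroup.b 1 : SurfaceGroup 3)))) = toAdd (SurfaceGroup.abelianize 3 ((SurfaceGroup.b 1 : SurfaceGroup 3)))
        rw [hb1]; simp only [map_mul, map_inv, toAdd_mul, toAdd_inv,
          commutatorElement_def]; abel
      · change toAdd (SurfaceGroup.abelianize 3 (β ((SurfaceGroup.a 2 : SurfaceGroup 3)))) = toAdd (SurfaceGroup.abelianize 3 ((SurfaceGroup.a 2 : SurfaceGroup 3)))
        rw [ha2]
      · change toAdd (SurfaceGroup.abelianize 3 (β ((SurfaceGroup.b 2 : SurfaceGroup 3)))) = toAdd (SurfaceGroup.abelianize 3 ((SurfaceGroup.b 2 : SurfaceGroup 3)))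
        rw [hb2]
    intro s
    have hs := DFunLike.congr_fun hhom s
    rw [MonoidHom.comp_apply, MulEquiv.coe_toMonoidHom] at hs
    exact mul_inv_mem_γ₂ (congrArg toAdd hs)
  -- the Johnson value of `β` at `b₀`: `β(b₀) b₀⁻¹ = [c₀, b₁⁻¹b₀b₁] [b₁⁻¹, b₀] ≡ [b₁, b₀]⁻¹`
  have hC : ∀ z : (SurfaceGroup 3) ⧸ ((⊤ : Subgroup (SurfaceGroup 3)).lowerCentralSeries 2), ⁅((⁅(SurfaceGroup.a 0 : SurfaceGroup 3), (SurfaceGroup.b 0 : SurfaceGroup 3)⁆ : (SurfaceGroup 3)) : (SurfaceGroup 3) ⧸ ((⊤ : Subgroup (SurfaceGroup 3)).lowerCentralSeries 2)), z⁆ = 1 := fun z => by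
    rw [quot_commutatorElement]; exact quot_class_two _ _ _
  have hJb0 : ((β ((SurfaceGroup.b 0 : SurfaceGroup 3)) * ((SurfaceGroup.b 0 : SurfaceGroup 3))⁻¹ : (SurfaceGroup 3)) : (SurfaceGroup 3) ⧸ ((⊤ : Subgroup (SurfaceGroup 3)).lowerCentralSeries 2)) = ((⁅(SurfaceGroup.b 1 : SurfaceGroup 3), (SurfaceGroup.b 0 : SurfaceGroup 3)⁆ : (SurfaceGroup 3)) : (SurfaceGroup 3) ⧸ ((⊤ : Subgroup (SurfaceGroup 3)).lowerCentralSeries 2))⁻¹ := by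
    have e : β ((SurfaceGroup.b 0 : SurfaceGroup 3)) * ((SurfaceGroup.b 0 : SurfaceGroup 3))⁻¹ = ⁅⁅(SurfaceGroup.a 0 : SurfaceGroup 3), (SurfaceGroup.b 0 : SurfaceGroup 3)⁆, ((SurfaceGroup.b 1 : SurfaceGroup 3))⁻¹ * ((SurfaceGroup.b 0 : SurfaceGroup 3)) * ((SurfaceGroup.b 1 : SurfaceGroup 3))⁆ * ⁅((SurfaceGroup.b 1 : SurfaceGroup 3))⁻¹, (SurfaceGroup.b 0 : SurfaceGroup 3)⁆ := by
      rw [hb0]; simp only [commutatorElement_def]; group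
    rw [e, QuotientGroup.mk_mul, quot_commutatorElement, hC, one_mul, quot_commutatorElement,
      QuotientGroup.mk_inv, c2_inv_left quot_class_two, ← quot_commutatorElement]
  -- the realiser `y₁ = g β g⁻¹`
  refine ⟨g.symm.trans (β.trans g), ?_, ?_, ia_conj hβIA g, ?_⟩
  · exact map_conj_of_map_eq g β hg0 hβ0
  · exact map_conj_of_map_eq g β hg1 hβ1
  -- the Johnson value of `y₁` at `b₀`
  rw [conj_tau]
  set t := g.symm ((SurfaceGroup.b 0 : SurfaceGroup 3)) with ht
  -- `t ≡ b₀ b₂⁻¹ (mod γ₂)` since `F₀⁻¹ δ_{b₀} = δ_{b₀} - δ_{b₂}`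
  have habt : toAdd (SurfaceGroup.abelianize 3 t) = toAdd (SurfaceGroup.abelianize 3 (((SurfaceGroup.b 0 : SurfaceGroup 3)) * ((SurfaceGroup.b 2 : SurfaceGroup 3))⁻¹)) := by
    have h1 : toAdd (SurfaceGroup.abelianize 3 ((SurfaceGroup.b 0 : SurfaceGroup 3))) = (moveZ (0 : Fin 3) 2 (by decide) (-1)) (toAdd (SurfaceGroup.abelianize 3 t)) := by rw [← hg, ht, MulEquiv.apply_symm_apply]
    have hc : toAdd (SurfaceGroup.abelianize 3 (((SurfaceGroup.b 0 : SurfaceGroup 3)) * ((SurfaceGroup.b 2 : SurfaceGroup 3))⁻¹)) = (Pi.single ((0 : Fin 3), true) (1 : ℤ) : surfaceGen 3 → ℤ) - (Pi.single ((2 : Fin 3), true) (1 : ℤ) : surfaceGen 3 → ℤ) := by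
      rw [map_mul, map_inv, toAdd_mul, toAdd_inv, SurfaceGroup.b, SurfaceGroup.b,
        SurfaceGroup.abelianize_of, SurfaceGroup.abelianize_of, toAdd_ofAdd, toAdd_ofAdd, sub_eq_add_neg]
    have hb : toAdd (SurfaceGroup.abelianize 3 ((SurfaceGroup.b 0 : SurfaceGroup 3))) = (Pi.single ((0 : Fin 3), true) (1 : ℤ) : surfaceGen 3 → ℤ) := by
      rw [SurfaceGroup.b, SurfaceGroup.abelianize_of, toAdd_ofAdd]
    have h2 : (moveZ (0 : Fin 3) 2 (by decide) (-1)) (toAdd (SurfaceGroup.abelianize 3 (((SurfaceGroup.b 0 : SurfaceGroup 3)) * ((SurfaceGroup.b 2 : SurfaceGroup 3))⁻¹))) = toAdd (SurfaceGroup.abelianize 3 ((SurfaceGroup.b 0 : SurfaceGroup 3))) := by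
      rw [hc, hb, map_sub, F0_single_b0, F0_single_of_ne ((2 : Fin 3), true) (by decide) (by decide)]
      abel
    exact (moveZ (0 : Fin 3) 2 (by decide) (-1)).injective (by rw [← h1, h2])
  have htc : t * (((SurfaceGroup.b 0 : SurfaceGroup 3)) * ((SurfaceGroup.b 2 : SurfaceGroup 3))⁻¹)⁻¹ ∈ ((⊤ : Subgroup (SurfaceGroup 3)).lowerCentralSeries 1) := mul_inv_mem_γ₂ habt
  have hJt : ((β t * t⁻¹ : (SurfaceGroup 3)) : (SurfaceGroup 3) ⧸ ((⊤ : Subgroup (SurfaceGroup 3)).lowerCentralSeries 2)) = ((⁅(SurfaceGroup.b 1 : SurfaceGroup 3), (SurfaceGroup.b 0 : SurfaceGroup 3)⁆ : (SurfaceGroup 3)) : (SurfaceGroup 3) ⧸ ((⊤ : Subgroup (SurfaceGroup 3)).lowerCentralSeries 2))⁻¹ := by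
    have e : t = (t * (((SurfaceGroup.b 0 : SurfaceGroup 3)) * ((SurfaceGroup.b 2 : SurfaceGroup 3))⁻¹)⁻¹) * (((SurfaceGroup.b 0 : SurfaceGroup 3)) * ((SurfaceGroup.b 2 : SurfaceGroup 3))⁻¹) := by group
    rw [e, ia_quot_mul hβIA, ia_quot_lcs hβIA htc, one_mul, ia_quot_mul hβIA, ia_quot_inv hβIA,
      hb2, mul_inv_cancel, QuotientGroup.mk_one, inv_one, mul_one, hJb0]
  -- apply `g`: `g` induces `F₀`, so `g b₁ ≡ b₁`, `g b₀ ≡ b₀ b₂ (mod γ₂)`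
  have hk1 : g ((SurfaceGroup.b 1 : SurfaceGroup 3)) * ((SurfaceGroup.b 1 : SurfaceGroup 3))⁻¹ ∈ ((⊤ : Subgroup (SurfaceGroup 3)).lowerCentralSeries 1) := mul_inv_mem_γ₂ (by
    rw [hg]; simp only [SurfaceGroup.b, SurfaceGroup.abelianize_of, toAdd_ofAdd]
    exact F0_single_of_ne _ (by decide) (by decide))
  have hk0 : g ((SurfaceGroup.b 0 : SurfaceGroup 3)) * (((SurfaceGroup.b 0 : SurfaceGroup 3)) * ((SurfaceGroup.b 2 : SurfaceGroup 3)))⁻¹ ∈ ((⊤ : Subgroup (SurfaceGroup 3)).lowerCentralSeries 1) := mul_inv_mem_γ₂ (by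
    rw [hg]; simp only [map_mul, toAdd_mul, SurfaceGroup.b, SurfaceGroup.abelianize_of, toAdd_ofAdd]
    exact F0_single_b0)
  have hgc : ⁅((g ((SurfaceGroup.b 1 : SurfaceGroup 3)) : (SurfaceGroup 3)) : (SurfaceGroup 3) ⧸ ((⊤ : Subgroup (SurfaceGroup 3)).lowerCentralSeries 2)), ((g ((SurfaceGroup.b 0 : SurfaceGroup 3)) : (SurfaceGroup 3)) : (SurfaceGroup 3) ⧸ ((⊤ : Subgroup (SurfaceGroup 3)).lowerCentralSeries 2))⁆ =
      ⁅(((SurfaceGroup.b 1 : SurfaceGroup 3) : (SurfaceGroup 3)) : (SurfaceGroup 3) ⧸ ((⊤ : Subgroup (SurfaceGroup 3)).lowerCentralSeries 2)), (((SurfaceGroup.b 0 : SurfaceGroup 3) : (SurfaceGroup 3)) : (SurfaceGroup 3) ⧸ ((⊤ : Subgroup (SurfaceGroup 3)).lowerCentralSeries 2))⁆ * ⁅(((SurfaceGroup.b 1 : SurfaceGroup 3) : (SurfaceGroup 3)) : (SurfaceGroup 3) ⧸ ((⊤ : Subgroup (SurfaceGroup 3)).lowerCentralSeries 2)), (((SurfaceGroup.b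 2 : SurfaceGroup 3) : (SurfaceGroup 3)) : (SurfaceGroup 3) ⧸ ((⊤ : Subgroup (SurfaceGroup 3)).lowerCentralSeries 2))⁆ := by
    have e1 : ((g ((SurfaceGroup.b 1 : SurfaceGroup 3)) : (SurfaceGroup 3)) : (SurfaceGroup 3) ⧸ ((⊤ : Subgroup (SurfaceGroup 3)).lowerCentralSeries 2)) = ((g ((SurfaceGroup.b 1 : SurfaceGroup 3)) * ((SurfaceGroup.b 1 : SurfaceGroup 3))⁻¹ : (SurfaceGroup 3)) : (SurfaceGroup 3) ⧸ ((⊤ : Subgroup (SurfaceGroup 3)).lowerCentralSeries 2)) * (((SurfaceGroup.b 1 : SurfaceGroup 3) : (SurfaceGroup 3)) : (SurfaceGroup 3) ⧸ ((⊤ : Subgroup (SurfaceGroup 3)).lowerCentralSeries 2)) := by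
      rw [← QuotientGroup.mk_mul, inv_mul_cancel_right]
    have e0 : ((g ((SurfaceGroup.b 0 : SurfaceGroup 3)) : (SurfaceGroup 3)) : (SurfaceGroup 3) ⧸ ((⊤ : Subgroup (SurfaceGroup 3)).lowerCentralSeries 2)) =
        ((g ((SurfaceGroup.b 0 : SurfaceGroup 3)) * (((SurfaceGroup.b 0 : SurfaceGroup 3)) * ((SurfaceGroup.b 2 : SurfaceGroup 3)))⁻¹ : (SurfaceGroup 3)) : (SurfaceGroup 3) ⧸ ((⊤ : Subgroup (SurfaceGroup 3)).lowerCentralSeries 2)) * ((((SurfaceGroup.b 0 : SurfaceGroup 3)) * ((SurfaceGroup.b 2 : SurfaceGroup 3)) : (SurfaceGroup 3)) : (SurfaceGroup 3) ⧸ ((⊤ : Subgroup (SurfaceGroup 3)).lowerCentralSeries 2)) := by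
      rw [← QuotientGroup.mk_mul, inv_mul_cancel_right]
    rw [e1, e0, commutatorElement_central_mul_eq (mk_lcs_mem_center hk1) (mk_lcs_mem_center hk0),
      QuotientGroup.mk_mul, c2_mul_right quot_class_two]
  have hmem : g (β t * t⁻¹ * ⁅(SurfaceGroup.b 1 : SurfaceGroup 3), (SurfaceGroup.b 0 : SurfaceGroup 3)⁆) ∈ ((⊤ : Subgroup (SurfaceGroup 3)).lowerCentralSeries 2) := by
    refine equiv_mem_lcs g ?_
    rw [← QuotientGroup.eq_one_iff, QuotientGroup.mk_mul, hJt, inv_mul_cancel]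
  rw [map_mul, map_commutatorElement] at hmem
  rw [← QuotientGroup.eq_one_iff] at hmem ⊢
  rw [QuotientGroup.mk_mul, quot_commutatorElement, hgc] at hmem
  rw [QuotientGroup.mk_mul, QuotientGroup.mk_mul, quot_commutatorElement, quot_commutatorElement]
  exact hmem

end Realise

/-- **Registered helper `helper_layerStepZeroRealiser`** (sub-goal of stub `stub_layerStepZero`, crux
stmt-SmoothPoincare4-14595): a Goeritz–Johnson realiser at genus `3`, in closed form (commutators
spelled out). [folklore] -/
theorem helper_layerStepZeroRealiser : (∀ (F : (surfaceGen 3 → ℤ) ≃ₗ[ℤ] (surfaceGen 3 → ℤ)) (ε : ℤ), (ε = 1 ∨ ε = -1) → (∀ u v : surfaceGen 3 → ℤ, symplForm (F u) (F v) = ε * symplForm u v) → (Submodule.span ℤ ((fun y => (Pi.single y (1 : ℤ) : surfaceGen 3 → ℤ)) '' s4CutSystem 0 0)).map F.toLinearMap = Submodule.span ℤ ((fun y => (Pi.single y (1 : ℤ) : surfaceGen 3 → ℤ)) '' s4CutSystem 0 0) → (Submodule.span ℤ ((fun y => (Pi.single y (1 : ℤ) : surfaceGen 3 → ℤ)) ''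 s4CutSystem 0 1)).map F.toLinearMap = Submodule.span ℤ ((fun y => (Pi.single y (1 : ℤ) : surfaceGen 3 → ℤ)) '' s4CutSystem 0 1) → ∃ x : SurfaceGroup 3 ≃* SurfaceGroup 3, (s4Kernels 0).map x.toMonoidHom = s4Kernels 0 ∧ (s4Kernels 1).map x.toMonoidHom = s4Kernels 1 ∧ ∀ s : SurfaceGroup 3, toAdd (SurfaceGroup.abelianize 3 (x s)) = F (toAdd (SurfaceGroup.abelianize 3 s))) → ∃ y₁ : SurfaceGroup 3 ≃* SurfaceGroup 3, (s4Kernels 0).map y₁.toMonoidHom = s4Kernels 0 ∧ (s4Kernels 1).map y₁.toMonoidHom = s4Kernels 1 ∧ (∀ s : SurfaceGroup 3, y₁ s * s⁻¹ ∈ (⊤ : Subgroup (SurfaceGroup 3)).lowerCentralSeries 1) ∧ y₁ (SurfaceGroup.b 0) * (SurfaceGroup.b 0)⁻¹ * ((SurfaceGroup.b 1 * SurfaceGroup.b 0 * (SurfaceGroup.b 1)⁻¹ * (SurfaceGroup.b 0)⁻¹) * (SurfaceGroup.b 1 * SurfaceGroup.b 2 * (SurfaceGroup.b 1)⁻¹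 * (SurfaceGroup.b 2)⁻¹)) ∈ (⊤ : Subgroup (SurfaceGroup 3)).lowerCentralSeries 2 :=
  fun hR => exists_goeritzJohnson hR

end Summit.SmoothPoincare4.SmoothPoincare4.Theorems.ShadowApproximation.NilpotentGenusClass

end
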